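import Literature.MathematicalPhysics.QuantumFieldTheory.Balaban1983to89.Node00.SmallFieldChiOfRecord
import Summits.QuantumFields.BalabanUV.T4Continuum.Spine.NE4.Targets
import Summits.QuantumFields.YangMills.Theorems.BalabanUVNodesN21ShellWeightKnit

/-!
# YM-DAG node N21 (= NE7c) ⊗ node U2 (N17's road) AT THE RECORD: THRESHOLD SYNCHRONISATION of the two runs' small-field tests of record —
# the band between the COUPLING-DEPENDENT thresholds `ε(g^A_j)η²` and `ε(g^B_{j+1})η²` of [Balaban1988Convergent] (2.4)∕(2.17) is thin RELATIVE to the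
# threshold, by a factor `(1 + p₀∕log γ⁻²)·γ²·|1∕(g^A_j)² − 1∕(g^B_{j+1})²|` — node U2's two-run coupling discrepancy `disc`, hence `≤ const·Cout·θ^j` under
# `Spine.NE4.U2Output` BY NAME: a SECOND geometric width family for road I's rate binder, absorbed by dag-n21-a's knit `n21_knit_levels`

Track A of `YM-PLAN.md` (cell `pub-ymgap`, HUMAN RULING D-0062), node **N21**; R134 fan-out seat `pub-ymgap-dag-n21-d` (s2), third module; the quantitative
form of located finding (L1) of `BalabanUVNodesN21SlotTestAtRecord` (p452009): the thresholds of record `Node00.epsOfRecord ν g k = g_k·A₀(log g_k⁻²)^{p₀}`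
are coupling-dependent, so at matched levels the two runs of the comparison test at DIFFERENT thresholds and the N21 shell must absorb the band between them —
an in-edge U2 ∕ N17 → N21 at the record not in YM-PLAN §2c's list.  Kernel bookkeeping BY NAME: 0 `def`, 0 `sorry`, standard axioms; COUNT-NEUTRAL;
`--supports` the K3 item `SpineGivenEndpointR11` (stmt-QuantumFields-19676).

WHAT IS PROVED ([folklore] real-variable bookkeeping; nothing of Bałaban's asserted).
* §1 COUPLING ALGEBRA in U2's currency `x = g⁻²`: for `0 < g ≤ g′`, `(g′ − g)∕g ≤ g′²·(1∕g² − 1∕g′²)` and `log g⁻² − log g′⁻² ≤ g′²·(1∕g² − 1∕g′²)`;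
  `a^{p} − b^{p} ≤ p·a^{p−1}·(a − b)` for `0 ≤ b ≤ a` (stated at `p + 1`).
* §2 THE PROFILE `ε(g) = g·A₀(log g⁻²)^{p₀}` (`A₀ ≥ 0`) on `0 < g ≤ g′ < 1`: `ε ≥ 0`; UPPER excursion `ε(g′) − ε(g) ≤ g′²(1∕g² − 1∕g′²)·ε(g)`; LOWER excursion
  `ε(g) − ε(g′) ≤ (p₀∕log g⁻²)·g′²(1∕g² − 1∕g′²)·ε(g)` (the profile need not be monotone; the logarithm's loss is first order with the small prefactor
  `p₀∕log g⁻²`); hence the TWO-SIDED band `|ε(g) − ε(g′)| ≤ (1 + p₀∕log g⁻²)·g′²·(1∕g² − 1∕g′²)·ε(g)`, and the SYMMETRIC form on a window `0 < g, g′ ≤ γ < 1`: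
  `|ε(g) − ε(g′)| ≤ (1 + p₀∕log γ⁻²)·γ²·|1∕g² − 1∕g′²|·max(ε(g), ε(g′))`.
* §3 AT THE RECORD, U2 BY NAME: along the tuned runs `runFlow D g₀ K`, `runFlow D g₀ (K+1)` of a datum, under `Spine.NE4.U2Output D g₀ Cout θ`
  (`disc ≤ Cout·θ^j`, `j ≤ K`) and the coupling window `(0, γ]`, `γ < 1`, the thresholds of record at matched levels satisfy
  `|ε(g^{(K)}_j) − ε(g^{(K+1)}_{j+1})| ≤ (1 + p₀∕log γ⁻²)·γ²·Cout·θ^j · max(…)` — the threshold band is GEOMETRICALLY THIN IN THE LEVEL with U2's rate.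
* §4 INTO ROAD I BY NAME: two geometric width families add to one (`c₁ϑ₁^j + c₂ϑ₂^j ≤ (c₁ + c₂)(ϑ₁ ∨ ϑ₂)^j`), and dag-n21-a's `n21_knit_levels` at the summed
  width (variable width N16 + threshold width U2): `n21_knit_levels_of_twoWidths`.

HONEST FRAMING.  `U2Output` (NE4's two-run coupling matching) is a HYPOTHESIS (node U2 is 0∕1, NOT PRINTED: [Balaban1987RG1] p. 264 defers the β-function
properties); the window is a hypothesis; the level ledgers of §4 are the term object's ([dict] + (M1)); nothing of Bałaban's is asserted or instantiated;
NE7c NOT proved; typed 28∕28, discharged count untouched; one finite four-torus programme at fixed `ε` — NOT ℝ⁴, NOT infinite volume, NOT OS, NOT a mass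
gap, NOT Clay.  Restate-immune.  No decl below carries a cite tag.
-/

noncomputable section

namespace Summit.QuantumFields.YangMills.Theorems.N21ThresholdSyncAtRecord

open Literature.MathematicalPhysics.QuantumFieldTheory.Balaban1983to89
open Literature.MathematicalPhysics.QuantumFieldTheory.Balaban1983to89.T4Continuum
open Literature.MathematicalPhysics.QuantumFieldTheory.Balaban1983to89.T4CouplingMatching (disc disc_nonneg)
open Summit.QuantumFields.BalabanUV.T4Continuum.Spine.NE4 (U2Output runFlow)
open T4IndicatorShell (ShellWeightBound)
open T4ShellMeasureLevels (LevelLedger LiveWindow)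

/-! ## §1 Coupling algebra in U2's currency `x = g⁻²` -/

/-- `(g′ − g)∕g ≤ g′²·(1∕g² − 1∕g′²)` for `0 < g ≤ g′`: the relative coupling mismatch is at most the `g⁻²`-discrepancy times `g′²`. [bookkeeping] -/
theorem relDiff_le_sq_mul_invSqDiff {g g' : ℝ} (hg : 0 < g) (hgg' : g ≤ g') : (g' - g) / g ≤ g' ^ 2 * (1 / g ^ 2 - 1 / g' ^ 2) := by
  have hg' : 0 < g' := lt_of_lt_of_le hg hgg'
  have h1 : 1 ≤ g' / g := (one_le_div hg).mpr hgg'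
  have e1 : (g' - g) / g = g' / g - 1 := by rw [sub_div, div_self hg.ne']
  have e2 : g' ^ 2 * (1 / g ^ 2 - 1 / g' ^ 2) = (g' / g) ^ 2 - 1 := by
    field_simp
  rw [e1, e2]
  nlinarith [sq_nonneg (g' / g - 1)]

/-- `log g⁻² − log g′⁻² ≤ g′²·(1∕g² − 1∕g′²)` for `0 < g ≤ g′` (`log y ≤ y − 1` at `y = g′²∕g²`). [bookkeeping] -/
theorem log_invSq_sub_le {g g' : ℝ} (hg : 0 < g) (hgg' : g ≤ g') :
    Real.log (g ^ 2)⁻¹ - Real.log (g' ^ 2)⁻¹ ≤ g' ^ 2 * (1 / g ^ 2 - 1 / g' ^ 2) := by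
  have hg' : 0 < g' := lt_of_lt_of_le hg hgg'
  have hq : 0 < g' ^ 2 / g ^ 2 := by positivity
  have hlog := Real.log_le_sub_one_of_pos hq
  have e1 : Real.log (g ^ 2)⁻¹ - Real.log (g' ^ 2)⁻¹ = Real.log (g' ^ 2 / g ^ 2) := by
    rw [Real.log_inv, Real.log_inv, Real.log_div (pow_ne_zero 2 hg'.ne') (pow_ne_zero 2 hg.ne')]
    ring
  have e2 : g' ^ 2 * (1 / g ^ 2 - 1 / g' ^ 2) = g' ^ 2 / g ^ 2 - 1 := by
    field_simp
  rw [e1, e2]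
  exact hlog

/-- `a^{p+1} − b^{p+1} ≤ (p+1)·a^{p}·(a − b)` for `0 ≤ b ≤ a` (mean-value bound for natural powers, by induction). [bookkeeping] -/
theorem powSucc_sub_powSucc_le_mul_sub {a b : ℝ} (hb : 0 ≤ b) (hba : b ≤ a) (p : ℕ) :
    a ^ (p + 1) - b ^ (p + 1) ≤ ((p : ℝ) + 1) * a ^ p * (a - b) := by
  have ha : 0 ≤ a := hb.trans hba
  induction p with
  | zero => simp
  | succ p ih =>
    have hbp : b ^ (p + 1) ≤ a ^ (p + 1) := pow_le_pow_left₀ hb hba _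
    have e : a ^ (p + 1 + 1) - b ^ (p + 1 + 1) = a * (a ^ (p + 1) - b ^ (p + 1)) + b ^ (p + 1) * (a - b) := by ring
    rw [e]
    have h1 : a * (a ^ (p + 1) - b ^ (p + 1)) ≤ a * (((p : ℝ) + 1) * a ^ p * (a - b)) := mul_le_mul_of_nonneg_left ih ha
    have h2 : b ^ (p + 1) * (a - b) ≤ a ^ (p + 1) * (a - b) := mul_le_mul_of_nonneg_right hbp (sub_nonneg.mpr hba)
    have e2 : a * (((p : ℝ) + 1) * a ^ p * (a - b)) + a ^ (p + 1) * (a - b) = ((↑(p + 1) : ℝ) + 1) * a ^ (p + 1) * (a - b) := by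
      push_cast; ring
    linarith

/-! ## §2 The threshold profile `ε(g) = g·A₀(log g⁻²)^{p₀}`: two-sided relative band in `g⁻²`-currency -/

section Profile

variable {A₀ : ℝ} (hA₀ : 0 ≤ A₀) (p₀ : ℕ)
include hA₀

/-- `0 ≤ ε(g) = g·p₀(g)` for `0 < g ≤ 1` (`p₀(g) ≥ 0` is the tree's `B16Cor3.p0Profile_nonneg`; re-derived inline to keep the import cone small).
[bookkeeping] -/
theorem eps_nonneg {g : ℝ} (hg : 0 < g) (hg1 : g ≤ 1) : 0 ≤ g * p0Profile A₀ p₀ g := by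
  have hone : 1 ≤ (g ^ 2)⁻¹ := one_le_inv_iff₀.mpr ⟨by positivity, by nlinarith⟩
  exact mul_nonneg hg.le (mul_nonneg hA₀ (pow_nonneg (Real.log_nonneg hone) _))

/-- **UPPER EXCURSION**: `ε(g′) − ε(g) ≤ g′²(1∕g² − 1∕g′²)·ε(g)` for `0 < g ≤ g′ ≤ 1` (the profile's logarithm is antitone in `g`, so `ε(g′) ≤ (g′∕g)ε(g)`).
[bookkeeping] -/
theorem eps_sub_eps_le_upper {g g' : ℝ} (hg : 0 < g) (hgg' : g ≤ g') (hg'1 : g' ≤ 1) :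
    g' * p0Profile A₀ p₀ g' - g * p0Profile A₀ p₀ g ≤ g' ^ 2 * (1 / g ^ 2 - 1 / g' ^ 2) * (g * p0Profile A₀ p₀ g) := by
  have hg' : 0 < g' := lt_of_lt_of_le hg hgg'
  -- antitonicity of the profile
  have hanti : p0Profile A₀ p₀ g' ≤ p0Profile A₀ p₀ g := by
    unfold p0Profile
    have hinv : (g' ^ 2)⁻¹ ≤ (g ^ 2)⁻¹ := inv_anti₀ (by positivity) (by nlinarith)
    have hone : 1 ≤ (g' ^ 2)⁻¹ := one_le_inv_iff₀.mpr ⟨by positivity, by nlinarith⟩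
    exact mul_le_mul_of_nonneg_left
      (pow_le_pow_left₀ (Real.log_nonneg hone) (Real.log_le_log (by positivity) hinv) p₀) hA₀
  have hp0 : 0 ≤ p0Profile A₀ p₀ g := by
    have hone : 1 ≤ (g ^ 2)⁻¹ := one_le_inv_iff₀.mpr ⟨by positivity, by nlinarith [hgg'.trans hg'1]⟩
    exact mul_nonneg hA₀ (pow_nonneg (Real.log_nonneg hone) _)
  have hrel := relDiff_le_sq_mul_invSqDiff hg hgg'
  calc g' * p0Profile A₀ p₀ g' - g * p0Profile A₀ p₀ g
      ≤ g' * p0Profile A₀ p₀ g - g * p0Profile A₀ p₀ g := by nlinarith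
    _ = (g' - g) / g * (g * p0Profile A₀ p₀ g) := by field_simp
    _ ≤ g' ^ 2 * (1 / g ^ 2 - 1 / g' ^ 2) * (g * p0Profile A₀ p₀ g) := mul_le_mul_of_nonneg_right hrel (mul_nonneg hg.le hp0)

/-- **LOWER EXCURSION**: `ε(g) − ε(g′) ≤ (p₀∕log g⁻²)·g′²(1∕g² − 1∕g′²)·ε(g)` for `0 < g ≤ g′ ≤ 1`, `g < 1` (the logarithm's loss, first order with the
small prefactor `p₀∕log g⁻²`; `log g⁻²` here is `Real.log (g²)⁻¹`). [bookkeeping] -/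
theorem eps_sub_eps_le_lower {g g' : ℝ} (hg : 0 < g) (hg1 : g < 1) (hgg' : g ≤ g') (hg'1 : g' ≤ 1) :
    g * p0Profile A₀ p₀ g - g' * p0Profile A₀ p₀ g' ≤
      (p₀ / Real.log (g ^ 2)⁻¹) * (g' ^ 2 * (1 / g ^ 2 - 1 / g' ^ 2)) * (g * p0Profile A₀ p₀ g) := by
  have hg' : 0 < g' := lt_of_lt_of_le hg hgg'
  set a := Real.log (g ^ 2)⁻¹ with ha_def
  set b := Real.log (g' ^ 2)⁻¹ with hb_def
  have ha : 0 < a := Real.log_pos ((one_lt_inv₀ (by positivity)).mpr (by nlinarith))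
  have hb : 0 ≤ b := Real.log_nonneg (one_le_inv_iff₀.mpr ⟨by positivity, by nlinarith⟩)
  have hba : b ≤ a := Real.log_le_log (by positivity) (inv_anti₀ (by positivity) (by nlinarith))
  have hD : 0 ≤ g' ^ 2 * (1 / g ^ 2 - 1 / g' ^ 2) := le_trans (div_nonneg (sub_nonneg.mpr hgg') hg.le) (relDiff_le_sq_mul_invSqDiff hg hgg')
  have hab : a - b ≤ g' ^ 2 * (1 / g ^ 2 - 1 / g' ^ 2) := log_invSq_sub_le hg hgg'
  have hpb : 0 ≤ A₀ * b ^ p₀ := mul_nonneg hA₀ (pow_nonneg hb _)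
  -- step 1: `ε(g) − ε(g′) ≤ g·(p(g) − p(g′))`
  have step1 : g * p0Profile A₀ p₀ g - g' * p0Profile A₀ p₀ g' ≤ g * (A₀ * a ^ p₀ - A₀ * b ^ p₀) := by
    have : g * (A₀ * b ^ p₀) ≤ g' * (A₀ * b ^ p₀) := mul_le_mul_of_nonneg_right hgg' hpb
    unfold p0Profile
    rw [← ha_def, ← hb_def]
    nlinarith
  -- step 2: `a^{p₀} − b^{p₀} ≤ (p₀ ∕ a)·a^{p₀}·(a − b)`
  have step2 : a ^ p₀ - b ^ p₀ ≤ (p₀ / a) * a ^ p₀ * (a - b) := by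
    cases p₀ with
    | zero => simp
    | succ p =>
      have h := powSucc_sub_powSucc_le_mul_sub hb hba p
      have e : ((↑(p + 1) : ℝ) / a) * a ^ (p + 1) * (a - b) = ((p : ℝ) + 1) * a ^ p * (a - b) := by
        rw [pow_succ]; push_cast; field_simp
      rw [e]; exact h
  have step3 : A₀ * a ^ p₀ - A₀ * b ^ p₀ ≤ A₀ * ((p₀ / a) * a ^ p₀ * (a - b)) := by
    rw [← mul_sub]; exact mul_le_mul_of_nonneg_left step2 hA₀
  have hcoef : 0 ≤ (p₀ : ℝ) / a * a ^ p₀ := by positivity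
  have step4 : (p₀ / a) * a ^ p₀ * (a - b) ≤ (p₀ / a) * a ^ p₀ * (g' ^ 2 * (1 / g ^ 2 - 1 / g' ^ 2)) :=
    mul_le_mul_of_nonneg_left hab hcoef
  calc g * p0Profile A₀ p₀ g - g' * p0Profile A₀ p₀ g'
      ≤ g * (A₀ * a ^ p₀ - A₀ * b ^ p₀) := step1
    _ ≤ g * (A₀ * ((p₀ / a) * a ^ p₀ * (g' ^ 2 * (1 / g ^ 2 - 1 / g' ^ 2)))) :=
        mul_le_mul_of_nonneg_left (step3.trans (mul_le_mul_of_nonneg_left step4 hA₀)) hg.le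
    _ = (p₀ / a) * (g' ^ 2 * (1 / g ^ 2 - 1 / g' ^ 2)) * (g * p0Profile A₀ p₀ g) := by
        unfold p0Profile; rw [← ha_def]; ring

/-- **THE TWO-SIDED THRESHOLD BAND** (ordered couplings): `|ε(g) − ε(g′)| ≤ (1 + p₀∕log g⁻²)·g′²(1∕g² − 1∕g′²)·ε(g)` for `0 < g ≤ g′ ≤ 1`, `g < 1`.
[bookkeeping] -/
theorem abs_eps_sub_eps_le {g g' : ℝ} (hg : 0 < g) (hg1 : g < 1) (hgg' : g ≤ g') (hg'1 : g' ≤ 1) :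
    |g * p0Profile A₀ p₀ g - g' * p0Profile A₀ p₀ g'| ≤
      (1 + p₀ / Real.log (g ^ 2)⁻¹) * (g' ^ 2 * (1 / g ^ 2 - 1 / g' ^ 2)) * (g * p0Profile A₀ p₀ g) := by
  have hup := eps_sub_eps_le_upper hA₀ p₀ hg hgg' hg'1
  have hlo := eps_sub_eps_le_lower hA₀ p₀ hg hg1 hgg' hg'1
  have hε : 0 ≤ g * p0Profile A₀ p₀ g := eps_nonneg hA₀ p₀ hg hg1.le
  have hD : 0 ≤ g' ^ 2 * (1 / g ^ 2 - 1 / g' ^ 2) := le_trans (div_nonneg (sub_nonneg.mpr hgg') hg.le) (relDiff_le_sq_mul_invSqDiff hg hgg')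
  have ha : 0 < Real.log (g ^ 2)⁻¹ := Real.log_pos ((one_lt_inv₀ (by positivity)).mpr (by nlinarith))
  have hc : 0 ≤ (p₀ : ℝ) / Real.log (g ^ 2)⁻¹ := by positivity
  rw [abs_le]
  constructor
  · -- lower: −(1 + c)·D·ε ≤ ε(g) − ε(g′)   ⟸  ε(g′) − ε(g) ≤ D·ε ≤ (1 + c)·D·ε
    nlinarith [mul_nonneg (mul_nonneg hc hD) hε]
  · nlinarith [mul_nonneg hD hε]

/-- **THE SYMMETRIC BAND ON A WINDOW `(0, γ]`, `γ < 1`**: for `0 < g, g′ ≤ γ`,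
`|ε(g) − ε(g′)| ≤ (1 + p₀∕log γ⁻²)·γ²·|1∕g² − 1∕g′²|·max(ε(g), ε(g′))` — the threshold band's width RELATIVE to the larger threshold is U2's discrepancy
`|1∕g² − 1∕g′²|` times the window constant `(1 + p₀∕log γ⁻²)·γ²`. [bookkeeping] -/
theorem abs_eps_sub_eps_le_window {γ g g' : ℝ} (hγ1 : γ < 1) (hg : 0 < g) (hgγ : g ≤ γ) (hg' : 0 < g') (hg'γ : g' ≤ γ) :
    |g * p0Profile A₀ p₀ g - g' * p0Profile A₀ p₀ g'| ≤
      (1 + p₀ / Real.log (γ ^ 2)⁻¹) * γ ^ 2 * |1 / g ^ 2 - 1 / g' ^ 2| *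
        max (g * p0Profile A₀ p₀ g) (g' * p0Profile A₀ p₀ g') := by
  have hγ : 0 < γ := lt_of_lt_of_le hg hgγ
  have hlogγ : 0 < Real.log (γ ^ 2)⁻¹ := Real.log_pos ((one_lt_inv₀ (by positivity)).mpr (by nlinarith))
  -- the ordered case, for `u ≤ v` in the window
  have key : ∀ u v : ℝ, 0 < u → u ≤ v → v ≤ γ →
      |u * p0Profile A₀ p₀ u - v * p0Profile A₀ p₀ v| ≤
        (1 + p₀ / Real.log (γ ^ 2)⁻¹) * γ ^ 2 * |1 / u ^ 2 - 1 / v ^ 2| *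
          max (u * p0Profile A₀ p₀ u) (v * p0Profile A₀ p₀ v) := by
    intro u v hu huv hvγ
    have hv : 0 < v := lt_of_lt_of_le hu huv
    have hu1 : u < 1 := lt_of_le_of_lt (huv.trans hvγ) hγ1
    have hv1 : v ≤ 1 := (hvγ.trans hγ1.le)
    have h := abs_eps_sub_eps_le hA₀ p₀ hu hu1 huv hv1
    have hεu : 0 ≤ u * p0Profile A₀ p₀ u := eps_nonneg hA₀ p₀ hu hu1.le
    have hD0 : 0 ≤ 1 / u ^ 2 - 1 / v ^ 2 := by
      rw [sub_nonneg]; exact one_div_le_one_div_of_le (by positivity) (by nlinarith)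
    have hD : |1 / u ^ 2 - 1 / v ^ 2| = 1 / u ^ 2 - 1 / v ^ 2 := abs_of_nonneg hD0
    -- compare the constants: `log γ⁻² ≤ log u⁻²`, `v² ≤ γ²`, `ε(u) ≤ max`
    have hlogu : Real.log (γ ^ 2)⁻¹ ≤ Real.log (u ^ 2)⁻¹ :=
      Real.log_le_log (by positivity) (inv_anti₀ (by positivity) (by nlinarith [huv.trans hvγ]))
    have hc : (p₀ : ℝ) / Real.log (u ^ 2)⁻¹ ≤ p₀ / Real.log (γ ^ 2)⁻¹ :=
      div_le_div_of_nonneg_left (Nat.cast_nonneg _) hlogγ hlogu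
    have hv2 : v ^ 2 ≤ γ ^ 2 := by nlinarith
    have hmax : u * p0Profile A₀ p₀ u ≤ max (u * p0Profile A₀ p₀ u) (v * p0Profile A₀ p₀ v) := le_max_left _ _
    have hlogu0 : 0 < Real.log (u ^ 2)⁻¹ := lt_of_lt_of_le hlogγ hlogu
    have hc0 : 0 ≤ 1 + (p₀ : ℝ) / Real.log (u ^ 2)⁻¹ := by
      have := div_nonneg (Nat.cast_nonneg p₀) hlogu0.le
      linarith
    have hcγ : 0 ≤ 1 + (p₀ : ℝ) / Real.log (γ ^ 2)⁻¹ := by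
      have := div_nonneg (Nat.cast_nonneg p₀) hlogγ.le
      linarith
    have hvD : 0 ≤ v ^ 2 * (1 / u ^ 2 - 1 / v ^ 2) := mul_nonneg (by positivity) hD0
    have hγD : 0 ≤ γ ^ 2 * (1 / u ^ 2 - 1 / v ^ 2) := mul_nonneg (by positivity) hD0
    have hmax0 : 0 ≤ max (u * p0Profile A₀ p₀ u) (v * p0Profile A₀ p₀ v) := le_max_of_le_left hεu
    rw [hD]
    calc |u * p0Profile A₀ p₀ u - v * p0Profile A₀ p₀ v|
        ≤ (1 + p₀ / Real.log (u ^ 2)⁻¹) * (v ^ 2 * (1 / u ^ 2 - 1 / v ^ 2)) * (u * p0Profile A₀ p₀ u) := h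
      _ ≤ (1 + p₀ / Real.log (γ ^ 2)⁻¹) * (v ^ 2 * (1 / u ^ 2 - 1 / v ^ 2)) * (u * p0Profile A₀ p₀ u) :=
          mul_le_mul_of_nonneg_right (mul_le_mul_of_nonneg_right (by linarith) hvD) hεu
      _ ≤ (1 + p₀ / Real.log (γ ^ 2)⁻¹) * (γ ^ 2 * (1 / u ^ 2 - 1 / v ^ 2)) * (u * p0Profile A₀ p₀ u) :=
          mul_le_mul_of_nonneg_right (mul_le_mul_of_nonneg_left (mul_le_mul_of_nonneg_right hv2 hD0) hcγ) hεu
      _ ≤ (1 + p₀ / Real.log (γ ^ 2)⁻¹) * (γ ^ 2 * (1 / u ^ 2 - 1 / v ^ 2)) *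
            max (u * p0Profile A₀ p₀ u) (v * p0Profile A₀ p₀ v) :=
          mul_le_mul_of_nonneg_left hmax (mul_nonneg hcγ hγD)
      _ = _ := by ring
  rcases le_total g g' with h | h
  · exact key g g' hg h hg'γ
  · have := key g' g hg' h hgγ
    rwa [abs_sub_comm, abs_sub_comm (1 / g' ^ 2), max_comm] at this

end Profile

/-! ## §3 AT THE RECORD: the two runs' thresholds of record at matched levels, under `Spine.NE4.U2Output` BY NAME -/

section AtRecord

open Node00

variable {F : T4Family} {G : Type*} [GaugeGroup G] [MeasurableSpace G] [HaarData G]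

/-- **THE THRESHOLD BAND OF THE TWO RUNS' SMALL-FIELD TESTS OF RECORD IS GEOMETRICALLY THIN IN THE LEVEL (U2 BY NAME).**  Along the `K`-step and
`(K+1)`-step runs `runFlow D g₀ K`, `runFlow D g₀ (K+1)` of a datum `D` on a bare-coupling sequence `g₀`, with node U2's output `U2Output D g₀ Cout θ`
(`|1∕(g^{(K)}_j)² − 1∕(g^{(K+1)}_{j+1})²| ≤ Cout·θ^j` for `j ≤ K`) and both couplings at the matched levels in the window `(0, γ]`, `γ < 1`: the thresholds of
record (`Node00.epsOfRecord ν`, `0 ≤ ν.A₀`) satisfy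
`|ε(g^{(K)}_j) − ε(g^{(K+1)}_{j+1})| ≤ (1 + p₀∕log γ⁻²)·γ²·(Cout·θ^j)·max(ε(g^{(K)}_j), ε(g^{(K+1)}_{j+1}))`. [bookkeeping] -/
theorem abs_epsOfRecord_runs_sub_le_of_u2Output (ν : Stage7Numerics) (hA₀ : 0 ≤ ν.A₀) (D : FiniteEpsData F G) (g₀ : ℕ → ℝ) {Cout θ γ : ℝ}
    (hU2 : U2Output D g₀ Cout θ) (hγ1 : γ < 1) {K j : ℕ} (hj : j ≤ K)
    (hA : 0 < runFlow D g₀ K j) (hAγ : runFlow D g₀ K j ≤ γ)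
    (hB : 0 < runFlow D g₀ (K + 1) (j + 1)) (hBγ : runFlow D g₀ (K + 1) (j + 1) ≤ γ) :
    |epsOfRecord ν (runFlow D g₀ K) j - epsOfRecord ν (runFlow D g₀ (K + 1)) (j + 1)| ≤
      (1 + ν.p₀ / Real.log (γ ^ 2)⁻¹) * γ ^ 2 * (Cout * θ ^ j) *
        max (epsOfRecord ν (runFlow D g₀ K) j) (epsOfRecord ν (runFlow D g₀ (K + 1)) (j + 1)) := by
  have hw := abs_eps_sub_eps_le_window hA₀ ν.p₀ hγ1 hA hAγ hB hBγ
  obtain ⟨-, hdisc⟩ := hU2 K j hj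
  have hd : |1 / runFlow D g₀ K j ^ 2 - 1 / runFlow D g₀ (K + 1) (j + 1) ^ 2| ≤ Cout * θ ^ j := by
    simpa [disc] using hdisc
  have hγ : 0 < γ := lt_of_lt_of_le hA hAγ
  have hlogγ : 0 < Real.log (γ ^ 2)⁻¹ := Real.log_pos ((one_lt_inv₀ (by positivity)).mpr (by nlinarith))
  have hc : 0 ≤ (1 + ν.p₀ / Real.log (γ ^ 2)⁻¹) * γ ^ 2 := by positivity
  have hmax : 0 ≤ max (epsOfRecord ν (runFlow D g₀ K) j) (epsOfRecord ν (runFlow D g₀ (K + 1)) (j + 1)) :=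
    le_max_of_le_left (eps_nonneg hA₀ ν.p₀ hA (hAγ.trans hγ1.le))
  unfold epsOfRecord at hw hmax ⊢
  calc _ ≤ (1 + ν.p₀ / Real.log (γ ^ 2)⁻¹) * γ ^ 2 * |1 / runFlow D g₀ K j ^ 2 - 1 / runFlow D g₀ (K + 1) (j + 1) ^ 2| *
        max (runFlow D g₀ K j * p0Profile ν.A₀ ν.p₀ (runFlow D g₀ K j))
          (runFlow D g₀ (K + 1) (j + 1) * p0Profile ν.A₀ ν.p₀ (runFlow D g₀ (K + 1) (j + 1))) := hw
    _ ≤ _ := by gcongr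

end AtRecord

/-! ## §4 Into road I BY NAME: two geometric width families (variable width N16 + threshold width U2) add to one -/

/-- Two geometric rates add to one at the larger base: `c₁ϑ₁^j + c₂ϑ₂^j ≤ (c₁ + c₂)·(ϑ₁ ∨ ϑ₂)^j` (`c`, `ϑ ≥ 0`). [bookkeeping] -/
theorem two_rates_le_max_rate {c₁ c₂ ϑ₁ ϑ₂ : ℝ} (hc₁ : 0 ≤ c₁) (hc₂ : 0 ≤ c₂) (h₁ : 0 ≤ ϑ₁) (h₂ : 0 ≤ ϑ₂) (j : ℕ) :
    c₁ * ϑ₁ ^ j + c₂ * ϑ₂ ^ j ≤ (c₁ + c₂) * max ϑ₁ ϑ₂ ^ j := by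
  have e1 : ϑ₁ ^ j ≤ max ϑ₁ ϑ₂ ^ j := pow_le_pow_left₀ h₁ (le_max_left _ _) j
  have e2 : ϑ₂ ^ j ≤ max ϑ₁ ϑ₂ ^ j := pow_le_pow_left₀ h₂ (le_max_right _ _) j
  nlinarith [mul_le_mul_of_nonneg_left e1 hc₁, mul_le_mul_of_nonneg_left e2 hc₂]

section IntoKnit

variable {ι σA σB : Type*} {l₀ : ℝ} {T : ℕ → Finset ι} {A B shA shB : ℕ → ℝ → ι → ℝ}
  {SA : ℕ → Finset σA} {SB : ℕ → Finset σB} {pieceA : ℕ → ℝ → σA → ι → ℝ} {pieceB : ℕ → ℝ → σB → ι → ℝ}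
  {lvlA : ℕ → σA → ℕ} {lvlB : ℕ → σB → ℕ} {DA DB ρA ρB : ℕ → ℝ} {N₁ : ℕ} {νbar Dbar : ℝ}

/-- **ROAD I AT THE SUMMED WIDTH.**  dag-n21-a's knit `n21_knit_levels` with the two runs' level widths dominated by the SUM of two geometric families —
the VARIABLE width `c₁ϑ₁^j` (N16's two-run closeness, files 3∕6∕9 of the lineage) and the THRESHOLD width `c₂ϑ₂^j` (U2, §3) —: the rate binder is met at
base `ϑ := ϑ₁ ∨ ϑ₂` with constant `c₁ + c₂`, and `ShellWeightBound` follows for every summable `Wsh ≥ 2((N₁+1)ν̄D̄(c₁+c₂)ϑ^{−N₁})ϑ^K`.  CONDITIONAL on every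
displayed binder (the level ledgers = [dict] + (M1), the live windows = N20, `D ≤ D̄` = N12); NE7c NOT proved. [bookkeeping] -/
theorem n21_knit_levels_of_twoWidths {c₁ c₂ ϑ₁ ϑ₂ : ℝ} (hc₁ : 0 ≤ c₁) (hc₂ : 0 ≤ c₂) (h₁ : 0 < ϑ₁) (h₁' : ϑ₁ < 1) (h₂ : 0 ≤ ϑ₂) (h₂' : ϑ₂ < 1)
    (hA : LevelLedger l₀ T A shA SA pieceA lvlA DA ρA) (hB : LevelLedger l₀ T B shB SB pieceB lvlB DB ρB)
    (hwA : LiveWindow SA lvlA N₁ νbar) (hwB : LiveWindow SB lvlB N₁ νbar) (hDA : ∀ j, DA j ≤ Dbar) (hDB : ∀ j, DB j ≤ Dbar)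
    (hrateA : ∀ j, ρA j ≤ c₁ * ϑ₁ ^ j + c₂ * ϑ₂ ^ j) (hrateB : ∀ j, ρB j ≤ c₁ * ϑ₁ ^ j + c₂ * ϑ₂ ^ j)
    {Wsh : ℕ → ℝ} (hWsh : ∀ K, (2 * ((N₁ + 1) * νbar * Dbar * (c₁ + c₂) * (max ϑ₁ ϑ₂)⁻¹ ^ N₁)) * max ϑ₁ ϑ₂ ^ K ≤ Wsh K)
    (hsum : Summable Wsh) : ShellWeightBound l₀ T A B shA shB Wsh :=
  n21_knit_levels hA hB hwA hwB hDA hDB (lt_max_of_lt_left h₁) (max_lt h₁' h₂')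
    (fun j => (hrateA j).trans (two_rates_le_max_rate hc₁ hc₂ h₁.le h₂ j))
    (fun j => (hrateB j).trans (two_rates_le_max_rate hc₁ hc₂ h₁.le h₂ j)) hWsh hsum

end IntoKnit

end Summit.QuantumFields.YangMills.Theorems.N21ThresholdSyncAtRecord

end
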